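import Mathlib.Combinatorics.SetFamily.FourFunctions
import Mathlib.Combinatorics.SimpleGraph.Connectivity.Finite
import Literature.Probability.LatticeModels.RandomCluster
import HarnessLib

/-!
# The FKG inequality for the random-cluster model, proved

Topic `Literature/Probability/LatticeModels` (trunk `StatMech`). The tree's named fact
`Literature.Probability.LatticeModels.rcMeasure_fkg` (`RandomCluster.lean`; Fortuin–Kasteleyn–Ginibre 1971, Grimmett
2006, Thm. 3.8) is **discharged** (`rcMeasure_fkg_holds`): for `0 ≤ p ≤ 1`, `q ≥ 1`, every
finite graph `G`, every wired set `B` and all increasing events `A, A'`,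
`φ^B_{G,p,q}(A) φ^B_{G,p,q}(A') ≤ φ^B_{G,p,q}(A ∩ A')`.

Proof as in Grimmett 2006, Thm. 3.8 (i): the random-cluster weights
`w(ω) = p^{|ω|} (1-p)^{|E∖ω|} q^{k^B(ω)}` satisfy the FKG lattice condition
`w(ω) w(ω') ≤ w(ω ∧ ω') w(ω ∨ ω')` (Grimmett 2006, Thm. 2.19 / (3.11)) because the number of
open clusters is supermodular in the configuration,
`k(ω) + k(ω') ≤ k(ω ∩ ω') + k(ω ∪ ω')` (Grimmett 2006, proof of Thm. 3.8, eq. (3.12)); the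
abstract FKG inequality for log-supermodular weights on a finite distributive lattice is Mathlib's
`fkg` (a corollary of the Ahlswede–Daykin four functions theorem), here on the lattice
`Finset (Sym2 V)` of edge sets, applied to the indicator functions of the two increasing events.

The supermodularity of the cluster count is proved at the level of simple graphs on a finite
vertex type (`card_connectedComponent_supermodular`:
`k(H₁) + k(H₂) ≤ k(H₁ ⊓ H₂) + k(H₁ ⊔ H₂)` for the numbers of connected components), by adding
the edges of `H₂ ∖ H₁` one at a time to `H₁ ⊓ H₂` and to `H₁` simultaneously and comparing the
effect of one new edge `uv` on the two nested graphs: it lowers the number of components by one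
exactly when `u` and `v` were not yet joined, which happens for the smaller graph whenever it
happens for the larger (`card_connectedComponent_sup_edge_lt`,
`card_connectedComponent_le_sup_edge_add_one`, `card_connectedComponent_sup_edge_of_reachable`).

## References

* C. M. Fortuin, P. W. Kasteleyn, J. Ginibre, *Correlation inequalities on some partially
  ordered sets*, Comm. Math. Phys. 22 (1971) 89–103.
* G. Grimmett, *The Random-Cluster Model*, Springer (2006), Thm. 2.19 (FKG lattice condition
  implies positive association), Thm. 3.8 and eqs. (3.11)–(3.12) (the random-cluster measure
  satisfies it for `q ≥ 1`).
* Mathlib: `Mathlib.Combinatorics.SetFamily.FourFunctions` (`four_functions_theorem`, `fkg`),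
  `SimpleGraph.ConnectedComponent.card_le_card_of_le`.
-/

noncomputable section

open MeasureTheory Finset SimpleGraph

namespace Literature.Probability.LatticeModels

/-! ### Connected components after adding one edge -/

section Graph

variable {V : Type*}

/-- Reachability after adding the edge `uv` to `H`: a walk in `H ⊔ uv` either avoids the new
edge (so its endpoints are joined in `H`) or its endpoints are joined in `H` to `u` and `v`
respectively (in one of the two orders). [folklore] -/
theorem reachable_sup_edge_imp (H : SimpleGraph V) (u v : V) {x y : V}
    (h : (H ⊔ edge u v).Reachable x y) :
    H.Reachable x y ∨ (H.Reachable x u ∧ H.Reachable v y) ∨ (H.Reachable x v ∧ H.Reachable u y) := by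
  obtain ⟨p⟩ := h
  induction p with
  | nil => exact Or.inl (Reachable.refl _)
  | @cons a b c hab p ih =>
    rw [sup_adj, edge_adj] at hab
    have hab' : H.Reachable a b ∨ (a = u ∧ b = v) ∨ (a = v ∧ b = u) := by
      rcases hab with h | ⟨h, _⟩
      · exact Or.inl h.reachable
      · exact Or.inr h
    rcases hab' with hab | ⟨rfl, rfl⟩ | ⟨rfl, rfl⟩
    · rcases ih with h | ⟨h1, h2⟩ | ⟨h1, h2⟩
      · exact Or.inl (hab.trans h)
      · exact Or.inr (Or.inl ⟨hab.trans h1, h2⟩)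
      · exact Or.inr (Or.inr ⟨hab.trans h1, h2⟩)
    · rcases ih with h | ⟨h1, h2⟩ | ⟨_, h2⟩
      · exact Or.inr (Or.inl ⟨Reachable.refl _, h⟩)
      · exact Or.inl (h1.symm.trans h2)
      · exact Or.inl h2
    · rcases ih with h | ⟨_, h2⟩ | ⟨h1, h2⟩
      · exact Or.inr (Or.inr ⟨Reachable.refl _, h⟩)
      · exact Or.inl h2
      · exact Or.inl (h1.symm.trans h2)

/-- The map on connected components induced by adding the edge `uv` identifies at most the
components of `u` and `v`: if two vertices have the same component in `H ⊔ uv`, then either they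
have the same component in `H`, or their components in `H` are those of `u` and of `v` (in one
of the two orders). [folklore] -/
theorem connectedComponentMk_sup_edge_eq_imp (H : SimpleGraph V) (u v : V) {x y : V}
    (h : (H ⊔ edge u v).connectedComponentMk x = (H ⊔ edge u v).connectedComponentMk y) :
    H.connectedComponentMk x = H.connectedComponentMk y ∨
      (H.connectedComponentMk x = H.connectedComponentMk u ∧
        H.connectedComponentMk y = H.connectedComponentMk v) ∨
      (H.connectedComponentMk x = H.connectedComponentMk v ∧
        H.connectedComponentMk y = H.connectedComponentMk u) := by
  rcases reachable_sup_edge_imp H u v (ConnectedComponent.exact h) with h | ⟨h1, h2⟩ | ⟨h1, h2⟩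
  · exact Or.inl (ConnectedComponent.sound h)
  · exact Or.inr (Or.inl ⟨ConnectedComponent.sound h1, ConnectedComponent.sound h2.symm⟩)
  · exact Or.inr (Or.inr ⟨ConnectedComponent.sound h1, ConnectedComponent.sound h2.symm⟩)

variable [Finite V]

/-- Adding one edge lowers the number of connected components by at most one:
`k(H) ≤ k(H ⊔ uv) + 1`. [folklore] -/
theorem card_connectedComponent_le_sup_edge_add_one (H : SimpleGraph V) (u v : V) :
    Nat.card H.ConnectedComponent ≤ Nat.card (H ⊔ edge u v).ConnectedComponent + 1 := by
  classical
  set π : H.ConnectedComponent → (H ⊔ edge u v).ConnectedComponent :=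
    ConnectedComponent.map (Hom.ofLE le_sup_left) with hπ
  -- `π` is injective away from the component of `v`
  set S := {C : H.ConnectedComponent // C ≠ H.connectedComponentMk v} with hS
  have hinj : Function.Injective fun C : S ↦ π C.1 := by
    rintro ⟨C, hC⟩ ⟨C', hC'⟩ hCC'
    refine Subtype.ext ?_
    change C = C'
    induction C using ConnectedComponent.ind with
    | h a =>
      induction C' using ConnectedComponent.ind with
      | h b =>
        simp only [hπ, ConnectedComponent.map_mk, Hom.coe_ofLE, id_eq] at hCC'
        rcases connectedComponentMk_sup_edge_eq_imp H u v hCC' with h | ⟨_, h2⟩ | ⟨h1, _⟩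
        · exact h
        · exact absurd h2 hC'
        · exact absurd h1 hC
  have h1 : Nat.card S ≤ Nat.card (H ⊔ edge u v).ConnectedComponent :=
    Nat.card_le_card_of_injective _ hinj
  have h2 : Nat.card H.ConnectedComponent = Nat.card S + 1 := by
    rw [← Finite.card_option]
    exact Nat.card_congr (Equiv.optionSubtypeNe (H.connectedComponentMk v)).symm
  omega

/-- Adding an edge between two vertices that are already joined does not change the number of
connected components. [folklore] -/
theorem card_connectedComponent_sup_edge_of_reachable (H : SimpleGraph V) {u v : V}
    (huv : H.Reachable u v) :
    Nat.card (H ⊔ edge u v).ConnectedComponent = Nat.card H.ConnectedComponent := by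
  refine le_antisymm (ConnectedComponent.card_le_card_of_le le_sup_left) ?_
  refine Nat.card_le_card_of_injective (ConnectedComponent.map (Hom.ofLE le_sup_left)) ?_
  intro C C' hCC'
  induction C using ConnectedComponent.ind with
  | h a =>
    induction C' using ConnectedComponent.ind with
    | h b =>
      simp only [ConnectedComponent.map_mk, Hom.coe_ofLE, id_eq] at hCC'
      rcases connectedComponentMk_sup_edge_eq_imp H u v hCC' with h | ⟨h1, h2⟩ | ⟨h1, h2⟩
      · exact h
      · rw [h1, h2, ConnectedComponent.eq]; exact huv
      · rw [h1, h2, ConnectedComponent.eq]; exact huv.symm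

/-- Adding an edge between two vertices that are not yet joined strictly lowers the number of
connected components. [folklore] -/
theorem card_connectedComponent_sup_edge_lt (H : SimpleGraph V) {u v : V}
    (huv : ¬H.Reachable u v) :
    Nat.card (H ⊔ edge u v).ConnectedComponent < Nat.card H.ConnectedComponent := by
  classical
  haveI := Fintype.ofFinite H.ConnectedComponent
  haveI := Fintype.ofFinite (H ⊔ edge u v).ConnectedComponent
  rw [Nat.card_eq_fintype_card, Nat.card_eq_fintype_card]
  refine Fintype.card_lt_of_surjective_not_injective _
    (ConnectedComponent.surjective_map_ofLE (le_sup_left : H ≤ H ⊔ edge u v)) ?_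
  intro hinj
  have hne : u ≠ v := fun h ↦ huv (h ▸ Reachable.refl _)
  have hadj : (H ⊔ edge u v).Adj u v := by
    rw [sup_adj, edge_adj]; exact Or.inr ⟨Or.inl ⟨rfl, rfl⟩, hne⟩
  have := @hinj (H.connectedComponentMk u) (H.connectedComponentMk v) (by
    simp only [ConnectedComponent.map_mk, Hom.coe_ofLE, id_eq, ConnectedComponent.eq]
    exact hadj.reachable)
  exact huv (ConnectedComponent.eq.1 this)

/-- One induction step of the supermodularity of the number of components: for nested graphs
`K ≤ L` and a new edge `uv`, `k(K ⊔ uv) + k(L) ≤ k(K) + k(L ⊔ uv)` (the new edge merges two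
components of `K` whenever it merges two components of `L`). [folklore] -/
theorem card_connectedComponent_sup_edge_step {K L : SimpleGraph V} (hKL : K ≤ L) (u v : V) :
    Nat.card (K ⊔ edge u v).ConnectedComponent + Nat.card L.ConnectedComponent ≤
      Nat.card K.ConnectedComponent + Nat.card (L ⊔ edge u v).ConnectedComponent := by
  by_cases huv : L.Reachable u v
  · rw [card_connectedComponent_sup_edge_of_reachable L huv]
    have := ConnectedComponent.card_le_card_of_le (G := K) (G' := K ⊔ edge u v) le_sup_left
    omega
  · have hK : ¬K.Reachable u v := fun h ↦ huv (h.mono hKL)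
    have h1 := card_connectedComponent_sup_edge_lt K hK
    have h2 := card_connectedComponent_le_sup_edge_add_one L u v
    omega

/-- **The number of connected components is supermodular** on the lattice of simple graphs on a
finite vertex set: `k(H₁) + k(H₂) ≤ k(H₁ ⊓ H₂) + k(H₁ ⊔ H₂)` (Grimmett 2006, eq. (3.12), the
key to the FKG lattice condition for the random-cluster model). [cite: Grimmett2006, Thm. 3.8, eq. (3.12)] -/
theorem card_connectedComponent_supermodular (H₁ H₂ : SimpleGraph V) :
    Nat.card H₁.ConnectedComponent + Nat.card H₂.ConnectedComponent ≤
      Nat.card (H₁ ⊓ H₂).ConnectedComponent + Nat.card (H₁ ⊔ H₂).ConnectedComponent := by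
  classical
  -- add the edges of a finite set `T` to `H₁ ⊓ H₂` and to `H₁` simultaneously
  have key : ∀ T : Finset (Sym2 V),
      Nat.card H₁.ConnectedComponent +
          Nat.card ((H₁ ⊓ H₂) ⊔ fromEdgeSet (↑T : Set (Sym2 V))).ConnectedComponent ≤
        Nat.card (H₁ ⊓ H₂).ConnectedComponent +
          Nat.card (H₁ ⊔ fromEdgeSet (↑T : Set (Sym2 V))).ConnectedComponent := by
    intro T
    induction T using Finset.induction_on with
    | empty => simp [add_comm]
    | insert e T heT ih =>
      induction e using Sym2.ind with
      | h u v =>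
        have hins : fromEdgeSet (↑(insert s(u, v) T) : Set (Sym2 V)) =
            fromEdgeSet (↑T : Set (Sym2 V)) ⊔ edge u v := by
          rw [Finset.coe_insert, Set.insert_eq, fromEdgeSet_union, sup_comm]; rfl
        rw [hins, ← sup_assoc, ← sup_assoc]
        have hKL : (H₁ ⊓ H₂) ⊔ fromEdgeSet (↑T : Set (Sym2 V)) ≤
            H₁ ⊔ fromEdgeSet (↑T : Set (Sym2 V)) := sup_le_sup_right inf_le_left _
        have hstep := card_connectedComponent_sup_edge_step hKL u v
        omega
  -- take `T` = the edges of `H₂` not in `H₁`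
  haveI : Fintype (Sym2 V) := Fintype.ofFinite _
  obtain ⟨T, hT⟩ : ∃ T : Finset (Sym2 V), (↑T : Set (Sym2 V)) = H₂.edgeSet \ H₁.edgeSet :=
    ⟨(H₂.edgeSet \ H₁.edgeSet).toFinite.toFinset, Set.Finite.coe_toFinset _⟩
  have hK : (H₁ ⊓ H₂) ⊔ fromEdgeSet (↑T : Set (Sym2 V)) = H₂ := by
    ext a b
    simp only [hT, sup_adj, inf_adj, fromEdgeSet_adj, Set.mem_sdiff, mem_edgeSet, ne_eq]
    constructor
    · rintro (⟨_, h⟩ | ⟨⟨h, _⟩, _⟩) <;> exact h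
    · intro h
      by_cases h1 : H₁.Adj a b
      · exact Or.inl ⟨h1, h⟩
      · exact Or.inr ⟨⟨h, h1⟩, h.ne⟩
  have hL : H₁ ⊔ fromEdgeSet (↑T : Set (Sym2 V)) = H₁ ⊔ H₂ := by
    ext a b
    simp only [hT, sup_adj, fromEdgeSet_adj, Set.mem_sdiff, mem_edgeSet, ne_eq]
    constructor
    · rintro (h | ⟨⟨h, _⟩, _⟩)
      · exact Or.inl h
      · exact Or.inr h
    · rintro (h | h)
      · exact Or.inl h
      · by_cases h1 : H₁.Adj a b
        · exact Or.inl h1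
        · exact Or.inr ⟨⟨h, h1⟩, h.ne⟩
  have := key T
  rw [hK, hL] at this
  exact this

end Graph

/-! ### Supermodularity of the wired cluster count -/

section ClusterCount

variable {V : Type*} [Finite V]

/-- **Supermodularity of the number of open clusters** (with any wired set `B`):
`k^B(ω₁) + k^B(ω₂) ≤ k^B(ω₁ ∩ ω₂) + k^B(ω₁ ∪ ω₂)` (Grimmett 2006, eq. (3.12)). [cite: Grimmett2006, Thm. 3.8, eq. (3.12)] -/
theorem clusterCount_supermodular (ω₁ ω₂ : Percolation.BondConfig V) (B : Set V) :
    clusterCount ω₁ B + clusterCount ω₂ B ≤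
      clusterCount (ω₁ ∩ ω₂) B + clusterCount (ω₁ ∪ ω₂) B := by
  unfold clusterCount Percolation.openGraph
  have hinf : fromEdgeSet (ω₁ ∩ ω₂) ⊔ wired B =
      (fromEdgeSet ω₁ ⊔ wired B) ⊓ (fromEdgeSet ω₂ ⊔ wired B) := by
    rw [fromEdgeSet_inter, sup_inf_right]
  have hsup : fromEdgeSet (ω₁ ∪ ω₂) ⊔ wired B =
      (fromEdgeSet ω₁ ⊔ wired B) ⊔ (fromEdgeSet ω₂ ⊔ wired B) := by
    rw [fromEdgeSet_union, sup_sup_distrib_right]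
  rw [hinf, hsup]
  exact card_connectedComponent_supermodular _ _

end ClusterCount

/-! ### The FKG lattice condition for the random-cluster weights -/

section Finite

variable {V : Type*} [Fintype V] [DecidableEq V] (G : SimpleGraph V) [DecidableRel G.Adj]

/-- The random-cluster weight extended by `0` off the edge sets of `G` (a function on the finite
distributive lattice `Finset (Sym2 V)` of all edge sets) is nonnegative for `0 ≤ p ≤ 1`,
`0 ≤ q`. [cite: Grimmett2006, §1.2] -/
theorem rcWeight_ite_nonneg {p q : ℝ} (hp : p ∈ Set.Icc (0 : ℝ) 1) (hq : 0 ≤ q) (B : Set V)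
    (ω : Finset (Sym2 V)) : 0 ≤ (if ω ⊆ G.edgeFinset then rcWeight G p q B ω else 0) := by
  split_ifs
  · exact rcWeight_nonneg G hp hq B ω
  · exact le_rfl

/-- **The FKG lattice condition for the random-cluster weights** (Grimmett 2006, Thm. 3.8 (3.11)):
for `0 ≤ p ≤ 1` and `q ≥ 1`, the weight `w` (extended by `0` off the edge sets of `G`, so as to
live on the finite distributive lattice `Finset (Sym2 V)`) satisfies
`w(ω) w(ω') ≤ w(ω ∩ ω') w(ω ∪ ω')`, from the supermodularity of the cluster count and
`|ω| + |ω'| = |ω ∩ ω'| + |ω ∪ ω'|`. [cite: Grimmett2006, Thm. 3.8, eq. (3.11)] -/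
theorem rcWeight_lattice_condition {p q : ℝ} (hp : p ∈ Set.Icc (0 : ℝ) 1) (hq : 1 ≤ q)
    (B : Set V) (a b : Finset (Sym2 V)) :
    (if a ⊆ G.edgeFinset then rcWeight G p q B a else 0) *
        (if b ⊆ G.edgeFinset then rcWeight G p q B b else 0) ≤
      (if a ⊓ b ⊆ G.edgeFinset then rcWeight G p q B (a ⊓ b) else 0) *
        (if a ⊔ b ⊆ G.edgeFinset then rcWeight G p q B (a ⊔ b) else 0) := by
  have hq0 : 0 ≤ q := zero_le_one.trans hq
  by_cases ha : a ⊆ G.edgeFinset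
  swap
  · rw [if_neg ha, zero_mul]
    exact mul_nonneg (rcWeight_ite_nonneg G hp hq0 B _) (rcWeight_ite_nonneg G hp hq0 B _)
  by_cases hb : b ⊆ G.edgeFinset
  swap
  · rw [if_neg hb, mul_zero]
    exact mul_nonneg (rcWeight_ite_nonneg G hp hq0 B _) (rcWeight_ite_nonneg G hp hq0 B _)
  have hab : a ⊓ b ⊆ G.edgeFinset := (Finset.inter_subset_left).trans ha
  have hab' : a ⊔ b ⊆ G.edgeFinset := Finset.union_subset ha hb
  rw [if_pos ha, if_pos hb, if_pos hab, if_pos hab']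
  simp only [rcWeight]
  -- exponents of `p` and `1 - p` are modular, the cluster count is supermodular
  have hcard : #a + #b = #(a ⊓ b) + #(a ⊔ b) := by
    rw [Finset.inf_eq_inter, Finset.sup_eq_union, add_comm (#(a ∩ b)), Finset.card_union_add_card_inter]
  have hcard' : #(G.edgeFinset \ a) + #(G.edgeFinset \ b) =
      #(G.edgeFinset \ (a ⊓ b)) + #(G.edgeFinset \ (a ⊔ b)) := by
    rw [Finset.inf_eq_inter, Finset.sup_eq_union, sdiff_inter_distrib_right, Finset.sdiff_union_distrib,
      Finset.card_union_add_card_inter]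
  have hk : clusterCount (↑a : Percolation.BondConfig V) B + clusterCount (↑b : Percolation.BondConfig V) B ≤
      clusterCount (↑(a ⊓ b) : Percolation.BondConfig V) B + clusterCount (↑(a ⊔ b) : Percolation.BondConfig V) B := by
    rw [Finset.inf_eq_inter, Finset.sup_eq_union, Finset.coe_inter, Finset.coe_union]
    exact clusterCount_supermodular _ _ B
  have h0p : 0 ≤ p := hp.1
  have h1p : 0 ≤ 1 - p := sub_nonneg.2 hp.2
  calc p ^ #a * (1 - p) ^ #(G.edgeFinset \ a) * q ^ clusterCount (↑a : Percolation.BondConfig V) B *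
        (p ^ #b * (1 - p) ^ #(G.edgeFinset \ b) * q ^ clusterCount (↑b : Percolation.BondConfig V) B)
      = p ^ (#a + #b) * (1 - p) ^ (#(G.edgeFinset \ a) + #(G.edgeFinset \ b)) *
          q ^ (clusterCount (↑a : Percolation.BondConfig V) B + clusterCount (↑b : Percolation.BondConfig V) B) := by
        simp only [pow_add]; ring
    _ ≤ p ^ (#a + #b) * (1 - p) ^ (#(G.edgeFinset \ a) + #(G.edgeFinset \ b)) *
          q ^ (clusterCount (↑(a ⊓ b) : Percolation.BondConfig V) B +
            clusterCount (↑(a ⊔ b) : Percolation.BondConfig V) B) := by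
        gcongr
    _ = p ^ (#(a ⊓ b) + #(a ⊔ b)) *
          (1 - p) ^ (#(G.edgeFinset \ (a ⊓ b)) + #(G.edgeFinset \ (a ⊔ b))) *
          q ^ (clusterCount (↑(a ⊓ b) : Percolation.BondConfig V) B +
            clusterCount (↑(a ⊔ b) : Percolation.BondConfig V) B) := by rw [hcard, hcard']
    _ = _ := by simp only [pow_add]; ring

/-! ### Evaluating the random-cluster measure on an event -/

/-- The random-cluster measure of an event, as a finite sum over the edge sets of `G`:
`φ(A) = ∑_{ω ⊆ E, ω ∈ A} w(ω)/Z`. [cite: Grimmett2006, §1.2, eq. (1.2)] -/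
theorem rcMeasure_real_apply {p q : ℝ} (hp : p ∈ Set.Icc (0 : ℝ) 1) (hq : 0 < q) (B : Set V)
    (A : Set (Percolation.BondConfig V)) [DecidablePred (· ∈ A)] :
    (rcMeasure G p q B).real A =
      ∑ ω ∈ G.edgeFinset.powerset,
        if (↑ω : Percolation.BondConfig V) ∈ A then rcWeight G p q B ω / rcPartitionFunction G p q B else 0 := by
  have hZ := rcPartitionFunction_pos G hp hq B
  have hnn : ∀ ω, 0 ≤ rcWeight G p q B ω / rcPartitionFunction G p q B := fun ω ↦
    div_nonneg (rcWeight_nonneg G hp hq.le B ω) hZ.le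
  have h1 : (rcMeasure G p q B) A = ∑ ω ∈ G.edgeFinset.powerset,
      ENNReal.ofReal (if (↑ω : Percolation.BondConfig V) ∈ A then
        rcWeight G p q B ω / rcPartitionFunction G p q B else 0) := by
    simp only [rcMeasure, Measure.coe_finsetSum, Measure.coe_smul, Finset.sum_apply,
      Pi.smul_apply, smul_eq_mul, Measure.dirac_apply, Set.indicator_apply, Pi.one_apply,
      mul_ite, mul_one, mul_zero]
    refine Finset.sum_congr rfl fun ω _ ↦ ?_
    split_ifs <;> simp
  rw [measureReal_def, h1, ← ENNReal.ofReal_sum_of_nonneg, ENNReal.toReal_ofReal]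
  · exact Finset.sum_nonneg fun ω _ ↦ by split_ifs <;> [exact hnn ω; exact le_rfl]
  · intro ω _; split_ifs <;> [exact hnn ω; exact le_rfl]

/-- **The FKG inequality for the random-cluster model, proved** (the tree's named fact
`rcMeasure_fkg`: Fortuin–Kasteleyn–Ginibre 1971; Grimmett 2006, Thm. 3.8): for `0 ≤ p ≤ 1`,
`q ≥ 1`, any wired set `B` and increasing events `A, A'`,
`φ^B_{G,p,q}(A) φ^B_{G,p,q}(A') ≤ φ^B_{G,p,q}(A ∩ A')`. From the lattice condition
(`rcWeight_lattice_condition`) and the abstract FKG inequality on the finite distributive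
lattice of edge sets (Mathlib `fkg`), applied to the indicators of `A` and `A'`. [cite: Grimmett2006, Thm. 3.8] -/
theorem rcMeasure_fkg_holds : rcMeasure_fkg G := by
  intro p q hp hq B A A' hA hA'
  classical
  have hq0 : 0 < q := one_pos.trans_le hq
  have hZ := rcPartitionFunction_pos G hp hq0 B
  set w : Finset (Sym2 V) → ℝ := fun ω ↦ if ω ⊆ G.edgeFinset then rcWeight G p q B ω else 0
    with hw
  set f : Finset (Sym2 V) → ℝ := fun ω ↦ if (↑ω : Percolation.BondConfig V) ∈ A then 1 else 0 with hf
  set g : Finset (Sym2 V) → ℝ := fun ω ↦ if (↑ω : Percolation.BondConfig V) ∈ A' then 1 else 0 with hg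
  have hw0 : 0 ≤ w := fun ω ↦ rcWeight_ite_nonneg G hp hq0.le B ω
  have hf0 : 0 ≤ f := fun ω ↦ by simp only [hf, Pi.zero_apply]; split_ifs <;> norm_num
  have hg0 : 0 ≤ g := fun ω ↦ by simp only [hg, Pi.zero_apply]; split_ifs <;> norm_num
  have hfm : Monotone f := by
    intro a b hab
    simp only [hf]
    by_cases ha : (↑a : Percolation.BondConfig V) ∈ A
    · have hb : (↑b : Percolation.BondConfig V) ∈ A := hA (Finset.coe_subset.2 hab) ha
      simp [ha, hb]
    · simp only [ha, if_false]; split_ifs <;> norm_num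
  have hgm : Monotone g := by
    intro a b hab
    simp only [hg]
    by_cases ha : (↑a : Percolation.BondConfig V) ∈ A'
    · have hb : (↑b : Percolation.BondConfig V) ∈ A' := hA' (Finset.coe_subset.2 hab) ha
      simp [ha, hb]
    · simp only [ha, if_false]; split_ifs <;> norm_num
  have key := fkg f g w hw0 hf0 hg0 hfm hgm (fun a b ↦ rcWeight_lattice_condition G hp hq B a b)
  -- identify the four sums
  have hfilter : (Finset.univ : Finset (Finset (Sym2 V))).filter (· ⊆ G.edgeFinset) =
      G.edgeFinset.powerset := by
    ext ω; simp
  have hsum : ∀ F : Finset (Sym2 V) → ℝ,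
      ∑ ω, w ω * F ω = ∑ ω ∈ G.edgeFinset.powerset, rcWeight G p q B ω * F ω := by
    intro F
    rw [← hfilter, Finset.sum_filter]
    refine Finset.sum_congr rfl fun ω _ ↦ ?_
    simp only [hw]
    split_ifs <;> simp
  have hZsum : ∑ ω, w ω = rcPartitionFunction G p q B := by
    have := hsum fun _ ↦ 1
    simp only [mul_one] at this
    rw [this, rcPartitionFunction]
  have hA1 : (rcMeasure G p q B).real A = (∑ ω, w ω * f ω) / rcPartitionFunction G p q B := by
    rw [rcMeasure_real_apply G hp hq0 B A, hsum, Finset.sum_div]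
    refine Finset.sum_congr rfl fun ω _ ↦ ?_
    simp only [hf]; split_ifs <;> simp
  have hA2 : (rcMeasure G p q B).real A' = (∑ ω, w ω * g ω) / rcPartitionFunction G p q B := by
    rw [rcMeasure_real_apply G hp hq0 B A', hsum, Finset.sum_div]
    refine Finset.sum_congr rfl fun ω _ ↦ ?_
    simp only [hg]; split_ifs <;> simp
  have hA3 : (rcMeasure G p q B).real (A ∩ A') =
      (∑ ω, w ω * (f ω * g ω)) / rcPartitionFunction G p q B := by
    rw [rcMeasure_real_apply G hp hq0 B (A ∩ A'), hsum, Finset.sum_div]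
    refine Finset.sum_congr rfl fun ω _ ↦ ?_
    simp only [hf, hg, Set.mem_inter_iff]
    by_cases h1 : (↑ω : Percolation.BondConfig V) ∈ A <;> by_cases h2 : (↑ω : Percolation.BondConfig V) ∈ A' <;> simp [h1, h2]
  rw [hA1, hA2, hA3, div_mul_div_comm, div_le_div_iff₀ (mul_pos hZ hZ) hZ]
  rw [hZsum] at key
  nlinarith [mul_le_mul_of_nonneg_right key hZ.le]

end Finite

end Literature.Probability.LatticeModels
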